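import Mathlib.Analysis.InnerProductSpace.Calculus
import Mathlib.Analysis.SpecialFunctions.Pow.Deriv
import Mathlib.Analysis.Calculus.ContDiff.Bounds
import HarnessLib

/-!
# Symbol estimates for the Japanese bracket: all derivatives of `⟨x⟩^m = (1 + ‖x‖²)^{m/2}`

Analysis/FunctionSpaces support file (theorems only; no definition, no named fact). On a real
inner-product space `E` the functions `x ↦ (1 + ‖x‖²)^{m/2}`, `m ∈ ℝ`, satisfy the classical
`S^m_{1,0}` symbol estimates

  `‖Dⁿ (1 + ‖x‖²)^{m/2}‖ ≤ C_{n,m} (1 + ‖x‖²)^{(m-n)/2}`   (all `n ∈ ℕ`, all `x`)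

(Taylor 1981, Ch. II §1: `⟨ξ⟩^m ∈ S^m_{1,0}`), proved by strong induction on `n` simultaneously for
all `m`: `D⟨x⟩^m = m ⟨x⟩^{m-2} ⟨x, ·⟩`, then Leibniz' rule (`norm_iteratedFDeriv_smul_le`) against the
linear factor `innerSL ℝ`, whose derivatives of order `≥ 2` vanish, so that only the orders `n` and
`n - 1` of `⟨x⟩^{m-2}` enter. Corollary: for a continuous linear map `L`,
`‖Dⁿ (⟨x⟩^m • L x)‖ ≤ C (1 + ‖x‖²)^{(m+1-n)/2}`; in particular every derivative of `⟨x⟩^m • L x`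
is bounded when `m ≤ -1` (e.g. the field `x ↦ (a × x)/(1 + |x|²)²` on `ℝ³`).

## References

* M. E. Taylor, *Pseudodifferential Operators*, Princeton Univ. Press 1981, Ch. II §1 (the symbol
  classes `S^m_{ρ,δ}`; `⟨ξ⟩^m`). [Taylor1981]
-/

noncomputable section

open Set Function Filter
open scoped ContDiff Topology InnerProductSpace

namespace Literature.Analysis.FunctionSpaces

section Bracket

variable {E : Type*} [NormedAddCommGroup E] [InnerProductSpace ℝ E]
  {F : Type*} [NormedAddCommGroup F] [NormedSpace ℝ F]

omit [InnerProductSpace ℝ E] in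
/-- `0 < 1 + ‖x‖²`. [folklore] -/
private theorem bracket_pos (x : E) : 0 < 1 + ‖x‖ ^ 2 := by positivity

omit [InnerProductSpace ℝ E] in
/-- `‖x‖ ≤ (1 + ‖x‖²)^{1/2}`. [folklore] -/
private theorem norm_le_bracket_half (x : E) : ‖x‖ ≤ (1 + ‖x‖ ^ 2) ^ ((1 : ℝ) / 2) := by
  calc ‖x‖ = Real.sqrt (‖x‖ ^ 2) := (Real.sqrt_sq (norm_nonneg x)).symm
    _ ≤ Real.sqrt (1 + ‖x‖ ^ 2) := Real.sqrt_le_sqrt (by linarith)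
    _ = (1 + ‖x‖ ^ 2) ^ ((1 : ℝ) / 2) := Real.sqrt_eq_rpow _

omit [InnerProductSpace ℝ E] in
/-- `‖x‖ (1+‖x‖²)^{(a-1)/2} ≤ (1+‖x‖²)^{a/2}`. [folklore] -/
private theorem norm_mul_bracket_le (a : ℝ) (x : E) :
    (1 + ‖x‖ ^ 2) ^ ((a - 1) / 2) * ‖x‖ ≤ (1 + ‖x‖ ^ 2) ^ (a / 2) := by
  calc (1 + ‖x‖ ^ 2) ^ ((a - 1) / 2) * ‖x‖
      ≤ (1 + ‖x‖ ^ 2) ^ ((a - 1) / 2) * (1 + ‖x‖ ^ 2) ^ ((1 : ℝ) / 2) := by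
        gcongr
        exact norm_le_bracket_half x
    _ = (1 + ‖x‖ ^ 2) ^ (a / 2) := by
        rw [← Real.rpow_add (bracket_pos x)]
        congr 1
        ring

omit [InnerProductSpace ℝ E] in
/-- Monotonicity in the exponent: `(1+‖x‖²)^{a} ≤ (1+‖x‖²)^{b}` for `a ≤ b`. [folklore] -/
private theorem bracket_rpow_mono {a b : ℝ} (hab : a ≤ b) (x : E) :
    (1 + ‖x‖ ^ 2) ^ a ≤ (1 + ‖x‖ ^ 2) ^ b :=
  Real.rpow_le_rpow_of_exponent_le (by nlinarith [norm_nonneg x]) hab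

/-- **The derivative of `⟨x⟩^m`**: `D (1+‖x‖²)^{m/2} = (m (1+‖x‖²)^{(m-2)/2}) ⟨x, ·⟩`
(Taylor 1981, Ch. II §1). [cite: Taylor1981, Ch. II §1] -/
theorem hasFDerivAt_one_add_norm_sq_rpow (m : ℝ) (x : E) :
    HasFDerivAt (fun y : E => (1 + ‖y‖ ^ 2) ^ (m / 2))
      ((m * (1 + ‖x‖ ^ 2) ^ ((m - 2) / 2)) • innerSL ℝ x) x := by
  have h1 : HasFDerivAt (fun y : E => 1 + ‖y‖ ^ 2) (2 • innerSL ℝ x) x :=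
    (hasStrictFDerivAt_norm_sq x).hasFDerivAt.const_add 1
  have h2 := h1.rpow_const (p := m / 2) (Or.inl (bracket_pos x).ne')
  convert h2 using 1
  ext v
  simp only [two_smul, smul_add, add_apply, FunLike.coe_smul,
    Pi.smul_apply, smul_eq_mul]
  rw [show m / 2 - 1 = (m - 2) / 2 by ring]
  ring

/-- `fderiv` form of `hasFDerivAt_one_add_norm_sq_rpow`. [cite: Taylor1981, Ch. II §1] -/
theorem fderiv_one_add_norm_sq_rpow (m : ℝ) :
    fderiv ℝ (fun y : E => (1 + ‖y‖ ^ 2) ^ (m / 2)) =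
      fun x => (m * (1 + ‖x‖ ^ 2) ^ ((m - 2) / 2)) • innerSL ℝ x :=
  funext fun x => (hasFDerivAt_one_add_norm_sq_rpow m x).fderiv

/-- `⟨x⟩^m` is smooth (Taylor 1981, Ch. II §1). [cite: Taylor1981, Ch. II §1] -/
theorem contDiff_one_add_norm_sq_rpow (m : ℝ) {n : WithTop ℕ∞} :
    ContDiff ℝ n (fun y : E => (1 + ‖y‖ ^ 2) ^ (m / 2)) :=
  (contDiff_const.add (contDiff_norm_sq ℝ)).rpow_const_of_ne fun x => (bracket_pos x).ne'

/-- Derivatives of a continuous linear map of order `≥ 2` vanish. [folklore] -/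
private theorem iteratedFDeriv_add_two_clm (L : E →L[ℝ] F) (k : ℕ) (x : E) :
    iteratedFDeriv ℝ (k + 2) (fun y => L y) x = 0 := by
  have h2 : (fderiv ℝ fun y => L y) = fun _ => L := by
    funext y; exact L.fderiv
  rw [iteratedFDeriv_succ_eq_comp_right]
  simp only [Function.comp_apply]
  rw [h2, iteratedFDeriv_const_of_ne (by omega) L]
  simp only [Pi.zero_apply]
  exact (continuousMultilinearCurryRightEquiv' ℝ (k + 1) E F).symm.map_zero

/-- Derivative of order `1` of a continuous linear map: norm `≤ ‖L‖`. [folklore] -/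
private theorem norm_iteratedFDeriv_one_clm (L : E →L[ℝ] F) (x : E) :
    ‖iteratedFDeriv ℝ 1 (fun y => L y) x‖ ≤ ‖L‖ := by
  rw [← norm_iteratedFDeriv_fderiv, norm_iteratedFDeriv_zero]
  have : fderiv ℝ (fun y => L y) x = L := L.fderiv
  rw [this]

/-- **Leibniz against a linear factor.** If the scalar function `f` is smooth and `L` is continuous
linear, then for `n = k + 1`,
`‖Dⁿ (f • L)‖ ≤ (k+1) ‖Dᵏ f‖ ‖L‖ + ‖D^{k+1} f‖ ‖L x‖`, and `‖D⁰(f • L) x‖ = |f x| ‖L x‖`.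
[folklore] -/
private theorem norm_iteratedFDeriv_smul_clm_succ_le {f : E → ℝ} (hf : ContDiff ℝ ∞ f)
    (L : E →L[ℝ] F) (k : ℕ) (x : E) :
    ‖iteratedFDeriv ℝ (k + 1) (fun y => f y • L y) x‖ ≤
      ((k : ℝ) + 1) * ‖iteratedFDeriv ℝ k f x‖ * ‖L‖ +
        ‖iteratedFDeriv ℝ (k + 1) f x‖ * ‖L x‖ := by
  have hg : ContDiff ℝ ∞ (fun y => L y) := L.contDiff
  have hle := norm_iteratedFDeriv_smul_le (𝕜 := ℝ) hf hg x (n := k + 1)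
    (WithTop.coe_le_coe.2 le_top)
  refine hle.trans ?_
  -- split off the two top terms; the rest vanishes
  rw [Finset.sum_range_succ, Finset.sum_range_succ]
  have hzero : ∑ i ∈ Finset.range k, ((k + 1).choose i : ℝ) * ‖iteratedFDeriv ℝ i f x‖ *
      ‖iteratedFDeriv ℝ (k + 1 - i) (fun y => L y) x‖ = 0 := by
    refine Finset.sum_eq_zero fun i hi => ?_
    have hi' : i < k := Finset.mem_range.1 hi
    obtain ⟨j, hj⟩ : ∃ j, k + 1 - i = j + 2 := ⟨k - 1 - i, by omega⟩
    rw [hj, iteratedFDeriv_add_two_clm L j x, norm_zero, mul_zero]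
  rw [hzero, zero_add]
  have h1 : ((k + 1).choose k : ℝ) = k + 1 := by
    rw [Nat.choose_succ_self_right]; push_cast; ring
  have h2 : ((k + 1).choose (k + 1) : ℝ) = 1 := by simp
  have h3 : k + 1 - k = 1 := by omega
  have h4 : k + 1 - (k + 1) = 0 := by omega
  rw [h1, h2, h3, h4, norm_iteratedFDeriv_zero, one_mul]
  gcongr
  · exact norm_iteratedFDeriv_one_clm L x

/-- Order-zero case of the Leibniz bound: `‖D⁰ (f • L) x‖ = ‖f x‖ ‖L x‖`. [folklore] -/
private theorem norm_iteratedFDeriv_smul_clm_zero (f : E → ℝ) (L : E →L[ℝ] F) (x : E) :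
    ‖iteratedFDeriv ℝ 0 (fun y => f y • L y) x‖ = ‖f x‖ * ‖L x‖ := by
  rw [norm_iteratedFDeriv_zero, norm_smul]

/-- **`S^m_{1,0}` symbol estimates for the Japanese bracket** (Taylor 1981, Ch. II §1): for every
`n ∈ ℕ` and `m ∈ ℝ` there is `C ≥ 0` with `‖Dⁿ (1+‖x‖²)^{m/2}‖ ≤ C (1+‖x‖²)^{(m-n)/2}` for all `x`.
[cite: Taylor1981, Ch. II §1] -/
theorem norm_iteratedFDeriv_one_add_norm_sq_rpow_le (n : ℕ) (m : ℝ) :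
    ∃ C : ℝ, 0 ≤ C ∧ ∀ x : E,
      ‖iteratedFDeriv ℝ n (fun y : E => (1 + ‖y‖ ^ 2) ^ (m / 2)) x‖ ≤
        C * (1 + ‖x‖ ^ 2) ^ ((m - n) / 2) := by
  induction n using Nat.strong_induction_on generalizing m with
  | _ n ih =>
  rcases n with _ | k
  · refine ⟨1, zero_le_one, fun x => ?_⟩
    rw [norm_iteratedFDeriv_zero, Real.norm_of_nonneg (Real.rpow_nonneg (bracket_pos x).le _)]
    simp
  · -- `‖D^{k+1} ⟨x⟩^m‖ = ‖D^k (f • innerSL)‖` with `f = m ⟨x⟩^{m-2}`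
    set f : E → ℝ := fun y => m * (1 + ‖y‖ ^ 2) ^ ((m - 2) / 2) with hf_def
    have hf : ContDiff ℝ ∞ f := contDiff_const.mul (contDiff_one_add_norm_sq_rpow (m - 2))
    have hfd : fderiv ℝ (fun y : E => (1 + ‖y‖ ^ 2) ^ (m / 2)) = fun y => f y • innerSL ℝ y :=
      fderiv_one_add_norm_sq_rpow m
    have hDf : ∀ (i : ℕ) (x : E), ‖iteratedFDeriv ℝ i f x‖ =
        |m| * ‖iteratedFDeriv ℝ i (fun y : E => (1 + ‖y‖ ^ 2) ^ ((m - 2) / 2)) x‖ := by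
      intro i x
      have hfm : f = m • fun y : E => (1 + ‖y‖ ^ 2) ^ ((m - 2) / 2) := by
        funext y; simp [hf_def, smul_eq_mul]
      rw [hfm, iteratedFDeriv_const_smul_apply ((contDiff_one_add_norm_sq_rpow (m - 2)).contDiffAt),
        norm_smul, Real.norm_eq_abs]
    rcases k with _ | k
    · -- order 1
      refine ⟨|m|, abs_nonneg m, fun x => ?_⟩
      rw [← norm_iteratedFDeriv_fderiv, hfd, norm_iteratedFDeriv_smul_clm_zero, innerSL_apply_norm,
        hf_def]
      simp only
      rw [norm_mul, Real.norm_eq_abs, Real.norm_of_nonneg (Real.rpow_nonneg (bracket_pos x).le _),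
        mul_assoc]
      gcongr
      have := norm_mul_bracket_le (m - 1) x
      rw [show m - 1 - 1 = m - 2 by ring] at this
      simpa using this
    · -- order `k + 2`: the two surviving Leibniz terms use orders `k + 1` and `k` of `⟨x⟩^{m-2}`
      obtain ⟨C₁, hC₁, h₁⟩ := ih (k + 1) (by omega) (m - 2)
      obtain ⟨C₀, hC₀, h₀⟩ := ih k (by omega) (m - 2)
      refine ⟨((k : ℝ) + 1) * (|m| * C₀) + |m| * C₁, by positivity, fun x => ?_⟩
      rw [← norm_iteratedFDeriv_fderiv, hfd]
      refine (norm_iteratedFDeriv_smul_clm_succ_le hf (innerSL ℝ (E := E)) k x).trans ?_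
      rw [hDf, hDf, innerSL_apply_norm]
      have hb0 := h₀ x
      have hb1 := h₁ x
      have hnL : ‖innerSL ℝ (E := E)‖ ≤ 1 :=
        ContinuousLinearMap.opNorm_le_bound _ zero_le_one fun y => by
          rw [innerSL_apply_norm, one_mul]
      -- target exponent `(m - (k+2))/2 = ((m-2) - k)/2`; second term gains `‖x‖ ≤ ⟨x⟩`
      have e1 : (m - 2 - (k : ℕ)) / 2 = (m - ↑(k + 1 + 1 : ℕ)) / 2 := by push_cast; ring
      have hterm1 : ((k : ℝ) + 1) * (|m| * ‖iteratedFDeriv ℝ k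
            (fun y : E => (1 + ‖y‖ ^ 2) ^ ((m - 2) / 2)) x‖) * ‖innerSL ℝ (E := E)‖ ≤
          ((k : ℝ) + 1) * (|m| * C₀) * (1 + ‖x‖ ^ 2) ^ ((m - ↑(k + 1 + 1 : ℕ)) / 2) := by
        calc ((k : ℝ) + 1) * (|m| * ‖iteratedFDeriv ℝ k
              (fun y : E => (1 + ‖y‖ ^ 2) ^ ((m - 2) / 2)) x‖) * ‖innerSL ℝ (E := E)‖
            ≤ ((k : ℝ) + 1) * (|m| * (C₀ * (1 + ‖x‖ ^ 2) ^ ((m - 2 - k) / 2))) * 1 := by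
              gcongr
          _ = ((k : ℝ) + 1) * (|m| * C₀) * (1 + ‖x‖ ^ 2) ^ ((m - ↑(k + 1 + 1 : ℕ)) / 2) := by
              rw [← e1]; ring
      have hterm2 : |m| * ‖iteratedFDeriv ℝ (k + 1)
            (fun y : E => (1 + ‖y‖ ^ 2) ^ ((m - 2) / 2)) x‖ * ‖x‖ ≤
          |m| * C₁ * (1 + ‖x‖ ^ 2) ^ ((m - ↑(k + 1 + 1 : ℕ)) / 2) := by
        calc |m| * ‖iteratedFDeriv ℝ (k + 1) (fun y : E => (1 + ‖y‖ ^ 2) ^ ((m - 2) / 2)) x‖ * ‖x‖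
            ≤ |m| * (C₁ * (1 + ‖x‖ ^ 2) ^ ((m - 2 - ↑(k + 1 : ℕ)) / 2)) * ‖x‖ := by gcongr
          _ = |m| * C₁ * ((1 + ‖x‖ ^ 2) ^ (((m - ↑(k + 1 + 1 : ℕ)) - 1) / 2) * ‖x‖) := by
              have : (m - 2 - ↑(k + 1 : ℕ)) / 2 = ((m - ↑(k + 1 + 1 : ℕ)) - 1) / 2 := by
                push_cast; ring
              rw [this]; ring
          _ ≤ |m| * C₁ * (1 + ‖x‖ ^ 2) ^ ((m - ↑(k + 1 + 1 : ℕ)) / 2) := by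
              gcongr
              exact norm_mul_bracket_le _ x
      calc ((k : ℝ) + 1) * (|m| * ‖iteratedFDeriv ℝ k
              (fun y : E => (1 + ‖y‖ ^ 2) ^ ((m - 2) / 2)) x‖) * ‖innerSL ℝ (E := E)‖ +
            |m| * ‖iteratedFDeriv ℝ (k + 1) (fun y : E => (1 + ‖y‖ ^ 2) ^ ((m - 2) / 2)) x‖ * ‖x‖
          ≤ ((k : ℝ) + 1) * (|m| * C₀) * (1 + ‖x‖ ^ 2) ^ ((m - ↑(k + 1 + 1 : ℕ)) / 2) +
            |m| * C₁ * (1 + ‖x‖ ^ 2) ^ ((m - ↑(k + 1 + 1 : ℕ)) / 2) := add_le_add hterm1 hterm2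
        _ = (((k : ℝ) + 1) * (|m| * C₀) + |m| * C₁) * (1 + ‖x‖ ^ 2) ^ ((m - ↑(k + 1 + 1 : ℕ)) / 2) := by
            ring

/-- **Corollary: `⟨x⟩^m` times a linear map.** For a continuous linear map `L` and all `n`, `m`:
`‖Dⁿ ((1+‖x‖²)^{m/2} • L x)‖ ≤ C (1+‖x‖²)^{(m+1-n)/2}` (the symbol `⟨x⟩^m L x` has order `m + 1`;
Taylor 1981, Ch. II §1, product of symbols). [cite: Taylor1981, Ch. II §1] -/
theorem norm_iteratedFDeriv_one_add_norm_sq_rpow_smul_le (n : ℕ) (m : ℝ) (L : E →L[ℝ] F) :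
    ∃ C : ℝ, 0 ≤ C ∧ ∀ x : E,
      ‖iteratedFDeriv ℝ n (fun y : E => (1 + ‖y‖ ^ 2) ^ (m / 2) • L y) x‖ ≤
        C * (1 + ‖x‖ ^ 2) ^ ((m + 1 - n) / 2) := by
  rcases n with _ | k
  · refine ⟨‖L‖, norm_nonneg L, fun x => ?_⟩
    rw [norm_iteratedFDeriv_smul_clm_zero, Real.norm_of_nonneg (Real.rpow_nonneg (bracket_pos x).le _)]
    calc (1 + ‖x‖ ^ 2) ^ (m / 2) * ‖L x‖
        ≤ (1 + ‖x‖ ^ 2) ^ (m / 2) * (‖L‖ * ‖x‖) := by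
          gcongr
          exact L.le_opNorm x
      _ = ‖L‖ * ((1 + ‖x‖ ^ 2) ^ ((m + 1 - 1) / 2) * ‖x‖) := by
          rw [show (m + 1 - 1) / 2 = m / 2 by ring]; ring
      _ ≤ ‖L‖ * (1 + ‖x‖ ^ 2) ^ ((m + 1 - ↑(0 : ℕ)) / 2) := by
          gcongr
          simpa using norm_mul_bracket_le (m + 1) x
  · obtain ⟨C₀, hC₀, h₀⟩ := norm_iteratedFDeriv_one_add_norm_sq_rpow_le (E := E) k m
    obtain ⟨C₁, hC₁, h₁⟩ := norm_iteratedFDeriv_one_add_norm_sq_rpow_le (E := E) (k + 1) m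
    refine ⟨((k : ℝ) + 1) * C₀ * ‖L‖ + C₁ * ‖L‖, by positivity, fun x => ?_⟩
    refine (norm_iteratedFDeriv_smul_clm_succ_le (contDiff_one_add_norm_sq_rpow m) L k x).trans ?_
    have e0 : (m - k) / 2 = (m + 1 - ↑(k + 1 : ℕ)) / 2 := by push_cast; ring
    have hterm1 : ((k : ℝ) + 1) * ‖iteratedFDeriv ℝ k (fun y : E => (1 + ‖y‖ ^ 2) ^ (m / 2)) x‖ * ‖L‖
        ≤ ((k : ℝ) + 1) * C₀ * ‖L‖ * (1 + ‖x‖ ^ 2) ^ ((m + 1 - ↑(k + 1 : ℕ)) / 2) := by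
      calc ((k : ℝ) + 1) * ‖iteratedFDeriv ℝ k (fun y : E => (1 + ‖y‖ ^ 2) ^ (m / 2)) x‖ * ‖L‖
          ≤ ((k : ℝ) + 1) * (C₀ * (1 + ‖x‖ ^ 2) ^ ((m - k) / 2)) * ‖L‖ := by gcongr; exact h₀ x
        _ = ((k : ℝ) + 1) * C₀ * ‖L‖ * (1 + ‖x‖ ^ 2) ^ ((m + 1 - ↑(k + 1 : ℕ)) / 2) := by
            rw [← e0]; ring
    have hterm2 : ‖iteratedFDeriv ℝ (k + 1) (fun y : E => (1 + ‖y‖ ^ 2) ^ (m / 2)) x‖ * ‖L x‖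
        ≤ C₁ * ‖L‖ * (1 + ‖x‖ ^ 2) ^ ((m + 1 - ↑(k + 1 : ℕ)) / 2) := by
      calc ‖iteratedFDeriv ℝ (k + 1) (fun y : E => (1 + ‖y‖ ^ 2) ^ (m / 2)) x‖ * ‖L x‖
          ≤ (C₁ * (1 + ‖x‖ ^ 2) ^ ((m - ↑(k + 1 : ℕ)) / 2)) * (‖L‖ * ‖x‖) := by
            gcongr
            · exact h₁ x
            · exact L.le_opNorm x
        _ = C₁ * ‖L‖ * ((1 + ‖x‖ ^ 2) ^ (((m + 1 - ↑(k + 1 : ℕ)) - 1) / 2) * ‖x‖) := by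
            have : (m - ↑(k + 1 : ℕ)) / 2 = ((m + 1 - ↑(k + 1 : ℕ)) - 1) / 2 := by push_cast; ring
            rw [this]; ring
        _ ≤ C₁ * ‖L‖ * (1 + ‖x‖ ^ 2) ^ ((m + 1 - ↑(k + 1 : ℕ)) / 2) := by
            gcongr
            exact norm_mul_bracket_le _ x
    calc ((k : ℝ) + 1) * ‖iteratedFDeriv ℝ k (fun y : E => (1 + ‖y‖ ^ 2) ^ (m / 2)) x‖ * ‖L‖ +
          ‖iteratedFDeriv ℝ (k + 1) (fun y : E => (1 + ‖y‖ ^ 2) ^ (m / 2)) x‖ * ‖L x‖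
        ≤ ((k : ℝ) + 1) * C₀ * ‖L‖ * (1 + ‖x‖ ^ 2) ^ ((m + 1 - ↑(k + 1 : ℕ)) / 2) +
          C₁ * ‖L‖ * (1 + ‖x‖ ^ 2) ^ ((m + 1 - ↑(k + 1 : ℕ)) / 2) := add_le_add hterm1 hterm2
      _ = (((k : ℝ) + 1) * C₀ * ‖L‖ + C₁ * ‖L‖) * (1 + ‖x‖ ^ 2) ^ ((m + 1 - ↑(k + 1 : ℕ)) / 2) := by
          ring

/-- **Bounded derivatives for `m ≤ -1`**: every derivative of `x ↦ (1+‖x‖²)^{m/2} • L x` is bounded on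
`E` when `m ≤ -1` (the symbol has order `m + 1 ≤ 0`; e.g. `x ↦ (a × x)/(1+|x|²)²` on `ℝ³`, `m = -4`).
[cite: Taylor1981, Ch. II §1] -/
theorem exists_bound_iteratedFDeriv_one_add_norm_sq_rpow_smul {m : ℝ} (hm : m ≤ -1) (L : E →L[ℝ] F)
    (n : ℕ) :
    ∃ C : ℝ, ∀ x : E, ‖iteratedFDeriv ℝ n (fun y : E => (1 + ‖y‖ ^ 2) ^ (m / 2) • L y) x‖ ≤ C := by
  obtain ⟨C, hC, h⟩ := norm_iteratedFDeriv_one_add_norm_sq_rpow_smul_le (E := E) n m L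
  refine ⟨C, fun x => (h x).trans ?_⟩
  have h1 : (1 + ‖x‖ ^ 2) ^ ((m + 1 - n) / 2) ≤ 1 :=
    Real.rpow_le_one_of_one_le_of_nonpos (by nlinarith [norm_nonneg x])
      (by have : (0 : ℝ) ≤ n := n.cast_nonneg; linarith)
  calc C * (1 + ‖x‖ ^ 2) ^ ((m + 1 - n) / 2) ≤ C * 1 := by gcongr
    _ = C := mul_one C

/-- **Bounded derivatives of `⟨x⟩^m` for `m ≤ 0`.** [cite: Taylor1981, Ch. II §1] -/
theorem exists_bound_iteratedFDeriv_one_add_norm_sq_rpow {m : ℝ} (hm : m ≤ 0) (n : ℕ) :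
    ∃ C : ℝ, ∀ x : E, ‖iteratedFDeriv ℝ n (fun y : E => (1 + ‖y‖ ^ 2) ^ (m / 2)) x‖ ≤ C := by
  obtain ⟨C, hC, h⟩ := norm_iteratedFDeriv_one_add_norm_sq_rpow_le (E := E) n m
  refine ⟨C, fun x => (h x).trans ?_⟩
  have h1 : (1 + ‖x‖ ^ 2) ^ ((m - n) / 2) ≤ 1 :=
    Real.rpow_le_one_of_one_le_of_nonpos (by nlinarith [norm_nonneg x])
      (by have : (0 : ℝ) ≤ n := n.cast_nonneg; linarith)
  calc C * (1 + ‖x‖ ^ 2) ^ ((m - n) / 2) ≤ C * 1 := by gcongr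
    _ = C := mul_one C

end Bracket

end Literature.Analysis.FunctionSpaces

end
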